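import Summits.QuantumAdvantage.QuantumAdvantage.Theorems.HolonomyDialAvoidHard

/-!
# HolonomyDial — Prefix (cell decomp-qadv, seat lens-2, generation 13; supports item 26531 `ExactnessDial.PolyLossOddU3`)

§P parts P1–P3 (v6): generic trit composition `comp_trits_mem`; prefix signs / phases as polynomials (`pre`, `psgnP`, `zparP`, `phiP`, `phiP_apply`, `gcond_iff_Z`); the certificate of a prefix bet (`devP`, `argP`, `cntA`, `certB3_ne` (kernel `decide`), `cntA_sum` = exclusion parity, `certP`, `certP_mem`, `cntA_argP`, `certP_ne_hol`).

Split (≤ 400 lines, part 12/13) of the node file `HOME/decomp-qadv-lens-2/g13/HolonomyDial.lean` (v6, sha256 47e78a64…,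
farm rc 0, no placeholders); declarations verbatim, namespace `Summit.QuantumAdvantage.QuantumAdvantage.Theorems.HolonomyDial`.
Record: NODE-g13.md.
-/

set_option linter.dupNamespace false

noncomputable section
open scoped Classical

namespace Summit.QuantumAdvantage.QuantumAdvantage.Theorems

open Finset
open Literature.Computability.QuantumComplexity Literature.Computability.QuantumComplexity.RingHLF
open Literature.Computability.MetaComplexity Literature.Computability.MetaComplexity.Smolensky
open Summit.QuantumAdvantage.AdviceFreeQNC0
open Summit.QuantumAdvantage.QuantumAdvantage.Theses (ExactnessDial.PolyLossOddU3 ExactnessDial.NoPerfectOdd3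
  ExactnessDial.NoPerfectConst3 ExactnessDial.MassStep3u ExactnessDial.OddToAll3 ExactnessDial.DPLift3
  ExactnessDial.MultiRingBridge3 ExactnessDial.closes)

namespace HolonomyDial

/-! ## §P  The PREFIX LAW (v6): polylog-degree bets confined to the polylog-PREFIX of the ring LOSE

A consequence of the crux `HolAvoidLoss3` that turns the sentence of NODE §2 («for deviations confined to positions
`k < (log n)^{O(1)}` the certificate has polylog degree») into a theorem.  By the trace form a win at an odd `x` means
`#{k ∈ Dev(x) : hol(x) + φ_k(x) ≢ 2}` is odd, `φ_k = k + W_k (mod 3)`; the three counts (one per hypothesis `h ∈ 𝔽₃`)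
have EVEN sum (EXCLUSION PARITY `cntA_sum`: for each `k` exactly one `h` has `h + φ_k ≡ 2`), so a win leaves a
hypothesis with an even count next to an odd one, and that hypothesis — the CERTIFICATE `cert(x)` — differs from
`hol(x)` (`certB3_ne`, a finite check).  When every deviation sits at a position `k < K` the certificate is a function of
`2K` trits: the deviation indicators `[P_k(x) = 1] ⊕ t_k(x)` (degree `2D + 2`, `devP`) and the phases `φ_k` (degree
`≤ k`: `φ_k = k + Σ_{i<k} (2 − 2·psgn_{i+1})`, `phiP_mem` — the prefix zero-signs `psgn` are `±` Smolensky characters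
`omMono 2` of the prefixes); by the generic TRIT-COMPOSITION lemma `comp_trits_mem` (an ARBITRARY function of `r`
trit-valued polynomials of degree `E` has degree `≤ 2rE`: `F(v) = Σ_a F(a)·Π_j (1 − (v_j − a_j)²)`) it is a polynomial
`certP` of degree `4K(3K+2) ≤ (log n)^{2c+5}` (`K = D = (log n)^c`), which AVOIDS `hol` wherever the bet wins
(`certP_ne_hol`); `HolAvoidLoss3` bounds that set.  Result: **`prefixLoss3 : PrefixLoss3`** (C = 1).
The residual of T is thereby LOCALISED: for every `c`, a polylog-degree strategy winning on more than
`(1 − 1/n)·2^{n−1}` odd inputs must, on some input, deviate from the canonical guess at distance `≥ (log n)^c` from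
the root — the far phases `W_k mod 3`, `k ≥ (log n)^c`, are exactly what T retains (`AvoidLift3`).
-/

section Prefix

variable {N : ℕ}

/-! ### P1  generic trit composition -/

/-- **trit composition**: an ARBITRARY function of finitely many low-degree trit-valued polynomials is low-degree —
`F(v₁,…,v_r) = Σ_a F(a)·Π_j [v_j = a_j]` with `[v = a] = 1 − (v − a)²` (`indP`). -/
theorem comp_trits_mem {ι : Type*} [Fintype ι] [DecidableEq ι] {E : ℕ} (v : ι → CubeFn (ZMod 3) N)
    (hv : ∀ j, v j ∈ lowDeg (ZMod 3) N E) (F : (ι → ZMod 3) → ZMod 3) :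
    (fun x => F (fun j => v j x)) ∈ lowDeg (ZMod 3) N (Fintype.card ι * (E + E)) := by
  have hprod : ∀ (a : ι → ZMod 3) (s : Finset ι),
      (∏ j ∈ s, indP (v j) (a j)) ∈ lowDeg (ZMod 3) N (s.card * (E + E)) := by
    intro a s
    refine Finset.induction_on s ?_ ?_
    · rw [Finset.prod_empty, Finset.card_empty, zero_mul]; exact one_mem_lowDeg 0
    · intro j s hj ih
      rw [Finset.prod_insert hj, Finset.card_insert_of_notMem hj]
      have e : (s.card + 1) * (E + E) = (E + E) + s.card * (E + E) := by ring
      rw [e]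
      exact mul_mem_lowDeg_add (indP_mem (hv j) (a j)) ih
  have key : (fun x => F (fun j => v j x)) =
      ∑ a : ι → ZMod 3, F a • ∏ j : ι, indP (v j) (a j) := by
    funext x
    rw [Finset.sum_apply]
    symm
    rw [Finset.sum_eq_single (fun j => v j x)]
    · rw [Pi.smul_apply, Finset.prod_apply, smul_eq_mul]
      rw [Finset.prod_eq_one (fun j _ => by rw [indP_apply, if_pos rfl]), mul_one]
    · intro a _ ha
      rw [Pi.smul_apply, Finset.prod_apply, smul_eq_mul]
      obtain ⟨j, hj⟩ : ∃ j, v j x ≠ a j := by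
        by_contra hcon
        push Not at hcon
        exact ha (funext fun j => (hcon j).symm)
      rw [Finset.prod_eq_zero (Finset.mem_univ j) (by rw [indP_apply, if_neg hj]), mul_zero]
    · intro h; exact absurd (Finset.mem_univ _) h
  rw [key]
  refine Submodule.sum_mem _ fun a _ => Submodule.smul_mem _ _ ?_
  have h := hprod a Finset.univ
  rwa [Finset.card_univ] at h

/-! ### P2  prefix signs and phases as polynomials -/

/-- the index set of the prefix `[0, k)`. -/
def pre (N k : ℕ) : Finset (Fin N) := univ.filter fun j : Fin N => j.val < k

/-- HolonomyDialPrefix helper `card_pre_le` (decomp-qadv land package; see the module docstring). -/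
theorem card_pre_le (N k : ℕ) : (pre N k).card ≤ k := by
  unfold pre
  calc (univ.filter fun j : Fin N => j.val < k).card
      = ((univ.filter fun j : Fin N => j.val < k).image Fin.val).card :=
        (Finset.card_image_of_injective _ Fin.val_injective).symm
    _ ≤ (Finset.range k).card := by
        refine Finset.card_le_card fun i hi => ?_
        rw [Finset.mem_image] at hi
        obtain ⟨j, hj, rfl⟩ := hi
        rw [mem_filter] at hj
        exact Finset.mem_range.2 hj.2
    _ = k := Finset.card_range k

/-- the prefix zero-sign `(−1)^{zpar x k}` as a polynomial of degree `≤ k`: `(−1)^{|pre|}·Π_{j<k} (if x_j then 2 else 1)`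
(a signed Smolensky character of the prefix). -/
def psgnP (N k : ℕ) : CubeFn (ZMod 3) N := ((-1 : ZMod 3) ^ (pre N k).card) • omMono (2 : ZMod 3) (pre N k)

/-- HolonomyDialPrefix helper `psgnP_mem` (decomp-qadv land package; see the module docstring). -/
theorem psgnP_mem (N k : ℕ) : psgnP N k ∈ lowDeg (ZMod 3) N k :=
  Submodule.smul_mem _ _ (omMono_mem_lowDeg _ (card_pre_le N k))

/-- HolonomyDialPrefix helper `psgnP_apply` (decomp-qadv land package; see the module docstring). -/
theorem psgnP_apply (k : ℕ) (x : Fin N → Bool) : psgnP N k x = if zpar x k then -1 else 1 := by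
  unfold psgnP
  rw [zpar_sign, Pi.smul_apply, smul_eq_mul]
  unfold omMono
  rw [show ((-1 : ZMod 3)) ^ (pre N k).card = ∏ _i ∈ pre N k, (-1 : ZMod 3) by rw [Finset.prod_const],
    ← Finset.prod_mul_distrib]
  unfold pre
  rw [Finset.prod_filter]
  refine Finset.prod_congr rfl fun j _ => ?_
  by_cases hj : j.val < k
  · rw [if_pos hj]
    have hb : ∀ b : Bool, (-1 : ZMod 3) * (if b = true then (2 : ZMod 3) else 1) =
        (if (j.val < k ∧ b = false) then (-1 : ZMod 3) else 1) := by
      intro b; cases b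
      · simp [hj]
      · simp [hj]; decide
    exact hb (x j)
  · rw [if_neg hj, if_neg (fun h => hj h.1)]

/-- the prefix-parity indicator `[zpar x k]` as a polynomial: `2 − 2·psgn`. -/
def zparP (N k : ℕ) : CubeFn (ZMod 3) N := (fun _ => (2 : ZMod 3)) - (2 : ZMod 3) • psgnP N k

/-- HolonomyDialPrefix helper `zparP_mem` (decomp-qadv land package; see the module docstring). -/
theorem zparP_mem (N k : ℕ) : zparP N k ∈ lowDeg (ZMod 3) N k :=
  Submodule.sub_mem _ (const_mem_lowDeg 2 k) (Submodule.smul_mem _ _ (psgnP_mem N k))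

/-- HolonomyDialPrefix helper `zparP_apply` (decomp-qadv land package; see the module docstring). -/
theorem zparP_apply (k : ℕ) (x : Fin N → Bool) : zparP N k x = if zpar x k then 1 else 0 := by
  simp only [zparP, Pi.sub_apply, Pi.smul_apply, smul_eq_mul, psgnP_apply]
  cases zpar x k <;> decide

/-- the PHASE `φ_k = k + W_k (mod 3)` as a polynomial of degree `≤ k` (`W_k = Σ_{i<k} [zpar x (i+1)]`). -/
def phiP (N k : ℕ) : CubeFn (ZMod 3) N := (fun _ => (k : ZMod 3)) + ∑ i ∈ pre N k, zparP N (i.val + 1)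

/-- HolonomyDialPrefix helper `phiP_mem` (decomp-qadv land package; see the module docstring). -/
theorem phiP_mem {k K : ℕ} (hk : k ≤ K) : phiP N k ∈ lowDeg (ZMod 3) N K := by
  refine Submodule.add_mem _ (const_mem_lowDeg _ _) (Submodule.sum_mem _ fun i hi => ?_)
  unfold pre at hi
  rw [mem_filter] at hi
  exact lowDeg_mono (by omega) (zparP_mem N (i.val + 1))

/-- HolonomyDialPrefix helper `Wk_cast` (decomp-qadv land package; see the module docstring). -/
theorem Wk_cast (x : Fin N → Bool) (k : ℕ) :
    ((Wk x k : ℕ) : ZMod 3) = ∑ i ∈ pre N k, (if zpar x (i.val + 1) then (1 : ZMod 3) else 0) := by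
  unfold Wk pre
  rw [show (univ.filter fun i : Fin N => i.val < k ∧ uCoord x i = true) =
      (univ.filter fun i : Fin N => i.val < k).filter (fun i => uCoord x i = true) by
        rw [Finset.filter_filter], Finset.card_filter, Nat.cast_sum]
  refine Finset.sum_congr rfl fun i _ => ?_
  rw [uCoord_eq_zpar]
  split_ifs <;> simp

/-- HolonomyDialPrefix helper `phiP_apply` (decomp-qadv land package; see the module docstring). -/
theorem phiP_apply (k : ℕ) (x : Fin N → Bool) : phiP N k x = ((k + Wk x k : ℕ) : ZMod 3) := by
  rw [Nat.cast_add, Wk_cast]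
  simp only [phiP, Pi.add_apply, Finset.sum_apply, zparP_apply]

/-- `ℕ ↦ 𝔽₃`: `m ≡ 2` iff the cast is `2`. -/
theorem natCast_eq_two_iff (m : ℕ) : ((m : ℕ) : ZMod 3) = 2 ↔ m % 3 = 2 := by
  constructor
  · intro h
    have h' := congrArg ZMod.val h
    rw [ZMod.val_natCast] at h'
    exact h'
  · intro h
    rw [← ZMod.natCast_mod m 3, h]; rfl

/-- the support condition `g_k` of the trace form in `𝔽₃`: `hol + φ_k ≠ 2`. -/
theorem gcond_iff_Z (x : Fin N → Bool) (k : ℕ) :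
    (k + N + Wk x k + Wk x (N - 1)) % 3 ≠ 2 ↔ ((hol x : ℕ) : ZMod 3) + ((k + Wk x k : ℕ) : ZMod 3) ≠ 2 := by
  have e : ((hol x : ℕ) : ZMod 3) + ((k + Wk x k : ℕ) : ZMod 3) =
      ((k + N + Wk x k + Wk x (N - 1) : ℕ) : ZMod 3) := by
    unfold hol Wtot
    rw [ZMod.natCast_mod]
    push_cast; ring
  rw [e]
  exact not_congr (natCast_eq_two_iff _).symm

/-! ### P3  the certificate of a prefix bet -/

/-- deviation indicator at position `j`: `[P_j = 1] ⊕ t_j` (degree `2D + 2`). -/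
def devP (P : Fin N → CubeFn (ZMod 3) N) (j : Fin N) : CubeFn (ZMod 3) N := xorP (indP (P j) 1) (tPoly j)

/-- HolonomyDialPrefix helper `devP_mem` (decomp-qadv land package; see the module docstring). -/
theorem devP_mem {D : ℕ} {P : Fin N → CubeFn (ZMod 3) N} (hP : ∀ i, P i ∈ lowDeg (ZMod 3) N D) (j : Fin N) :
    devP P j ∈ lowDeg (ZMod 3) N (D + D + 2) :=
  xorP_mem (indP_mem (hP j) 1) (tPoly_mem j)

/-- HolonomyDialPrefix helper `devP_apply` (decomp-qadv land package; see the module docstring). -/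
theorem devP_apply (P : Fin N → CubeFn (ZMod 3) N) (j : Fin N) (x : Fin N → Bool) :
    devP P j x = if xor (decide (P j x = 1)) (tGuess x j) then 1 else 0 := by
  unfold devP
  refine xorP_apply_bool _ _ x _ _ ?_ (tPoly_apply j x)
  rw [indP_apply]
  by_cases h : P j x = 1 <;> simp [h]

/-- HolonomyDialPrefix helper `ite01_eq_one` (decomp-qadv land package; see the module docstring). -/
theorem ite01_eq_one (b : Bool) : ((if b = true then (1 : ZMod 3) else 0) = 1) ↔ b = true := by
  cases b <;> simp

/-- the argument vector of the certificate: deviation indicators at the `K` prefix positions, then the `K` phases. -/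
def argP (K : ℕ) (hK : K ≤ N) (P : Fin N → CubeFn (ZMod 3) N) : Fin K ⊕ Fin K → CubeFn (ZMod 3) N
  | Sum.inl k => devP P (Fin.castLE hK k)
  | Sum.inr k => phiP N k.val

/-- HolonomyDialPrefix helper `argP_mem` (decomp-qadv land package; see the module docstring). -/
theorem argP_mem {K D : ℕ} (hK : K ≤ N) {P : Fin N → CubeFn (ZMod 3) N} (hP : ∀ i, P i ∈ lowDeg (ZMod 3) N D) :
    ∀ j, argP K hK P j ∈ lowDeg (ZMod 3) N (D + D + 2 + K) := by
  rintro (k | k)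
  · exact lowDeg_mono (by omega) (devP_mem hP _)
  · exact phiP_mem (by have := k.2; omega)

/-- under hypothesis `h`, the number of prefix deviations whose support condition holds, read off a trit vector. -/
def cntA (K : ℕ) (a : Fin K ⊕ Fin K → ZMod 3) (h : ZMod 3) : ℕ :=
  (univ.filter fun k : Fin K => a (Sum.inl k) = 1 ∧ h + a (Sum.inr k) ≠ 2).card

/-- from the three count parities: the hypothesis with an EVEN count sitting next to an odd one. -/
def certB3 (q0 q1 : Bool) : ZMod 3 :=
  if (!q0 && q1) = true then 0 else if (!q1 && q0) = true then 1 else 2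

/-- the finite heart: parities with even total, `h`'s parity odd ⟹ the certificate (read off the parities of the
hypotheses `0` and `1` alone) misses `h`. -/
theorem certB3_ne : ∀ (q0 q1 q2 : Bool) (h : ZMod 3), xor (xor q0 q1) q2 = false →
    (if h = 0 then q0 else if h = 1 then q1 else q2) = true → certB3 q0 q1 ≠ h := by
  decide

/-- HolonomyDialPrefix helper `certA` (decomp-qadv land package; see the module docstring). -/
def certA (K : ℕ) (a : Fin K ⊕ Fin K → ZMod 3) : ZMod 3 :=
  certB3 (decide (cntA K a 0 % 2 = 1)) (decide (cntA K a 1 % 2 = 1))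

/-- **EXCLUSION PARITY**: the three hypothesis counts have even sum (each deviation is counted by exactly two `h`). -/
theorem cntA_sum (K : ℕ) (a : Fin K ⊕ Fin K → ZMod 3) : (cntA K a 0 + cntA K a 1 + cntA K a 2) % 2 = 0 := by
  unfold cntA
  rw [Finset.card_filter, Finset.card_filter, Finset.card_filter, ← Finset.sum_add_distrib,
    ← Finset.sum_add_distrib, Finset.sum_nat_mod, Finset.sum_eq_zero, Nat.zero_mod]
  intro k _
  generalize a (Sum.inr k) = φ
  by_cases hd : a (Sum.inl k) = 1
  · simp only [hd, true_and]
    revert φ; decide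
  · simp [hd]

/-- HolonomyDialPrefix helper `xor_parities_false` (decomp-qadv land package; see the module docstring). -/
theorem xor_parities_false {c0 c1 c2 : ℕ} (h : (c0 + c1 + c2) % 2 = 0) :
    xor (xor (decide (c0 % 2 = 1)) (decide (c1 % 2 = 1))) (decide (c2 % 2 = 1)) = false := by
  rcases Nat.mod_two_eq_zero_or_one c0 with h0 | h0 <;> rcases Nat.mod_two_eq_zero_or_one c1 with h1 | h1 <;>
    rcases Nat.mod_two_eq_zero_or_one c2 with h2 | h2 <;> simp [h0, h1, h2] <;> omega

/-- HolonomyDialPrefix helper `sel_parity` (decomp-qadv land package; see the module docstring). -/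
theorem sel_parity {c : ZMod 3 → ℕ} {h : ZMod 3} (hodd : c h % 2 = 1) :
    (if h = 0 then decide (c 0 % 2 = 1) else if h = 1 then decide (c 1 % 2 = 1) else decide (c 2 % 2 = 1)) = true := by
  have h3 : ∀ h : ZMod 3, h = 0 ∨ h = 1 ∨ h = 2 := by decide
  rcases h3 h with rfl | rfl | rfl
  · rw [if_pos rfl]; exact decide_eq_true hodd
  · rw [if_neg (by decide), if_pos rfl]; exact decide_eq_true hodd
  · rw [if_neg (by decide), if_neg (by decide)]; exact decide_eq_true hodd

/-- **THE CERTIFICATE POLYNOMIAL** of a `K`-prefix bet `P`. -/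
def certP (K : ℕ) (hK : K ≤ N) (P : Fin N → CubeFn (ZMod 3) N) : CubeFn (ZMod 3) N :=
  fun x => certA K (fun j => argP K hK P j x)

/-- HolonomyDialPrefix helper `certP_mem` (decomp-qadv land package; see the module docstring). -/
theorem certP_mem {K D : ℕ} (hK : K ≤ N) {P : Fin N → CubeFn (ZMod 3) N} (hP : ∀ i, P i ∈ lowDeg (ZMod 3) N D) :
    certP K hK P ∈ lowDeg (ZMod 3) N ((K + K) * ((D + D + 2 + K) + (D + D + 2 + K))) := by
  have h := comp_trits_mem (ι := Fin K ⊕ Fin K) (E := D + D + 2 + K) (argP K hK P) (argP_mem hK hP) (certA K)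
  rwa [Fintype.card_sum, Fintype.card_fin] at h

/-- the certificate's counts are the trace-form counts. -/
theorem cntA_argP (K : ℕ) (hK : K ≤ N) (P : Fin N → CubeFn (ZMod 3) N) (x : Fin N → Bool)
    (hpre : ∀ i : Fin N, K ≤ i.val → decide (P i x = 1) = tGuess x i) (h : ZMod 3) :
    cntA K (fun j => argP K hK P j x) h =
      (univ.filter fun k : Fin N => xor (decide (P k x = 1)) (tGuess x k) = true ∧
        h + ((k.val + Wk x k.val : ℕ) : ZMod 3) ≠ 2).card := by
  unfold cntA
  rw [← Finset.card_map ⟨Fin.castLE hK, Fin.castLE_injective hK⟩]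
  congr 1
  ext j
  simp only [Finset.mem_map, mem_filter, mem_univ, true_and, Function.Embedding.coeFn_mk, argP,
    devP_apply, phiP_apply, ite01_eq_one]
  constructor
  · rintro ⟨k, ⟨h1, h2⟩, rfl⟩
    exact ⟨h1, by simpa using h2⟩
  · rintro ⟨h1, h2⟩
    have hjK : j.val < K := by
      by_contra hcon
      push Not at hcon
      rw [hpre j hcon, Bool.xor_self] at h1
      exact Bool.false_ne_true h1
    have ej : Fin.castLE hK ⟨j.val, hjK⟩ = j := Fin.ext rfl
    refine ⟨⟨j.val, hjK⟩, ⟨?_, ?_⟩, ej⟩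
    · rw [ej]; exact h1
    · simpa using h2

/-- **the certificate avoids the holonomy wherever a prefix bet wins.** -/
theorem certP_ne_hol (K : ℕ) (hK : K ≤ N) (P : Fin N → CubeFn (ZMod 3) N) (hN : 3 ≤ N)
    (x : Fin N → Bool) (hx : OddZeros x)
    (hpre : ∀ i : Fin N, K ≤ i.val → decide (P i x = 1) = tGuess x i)
    (hrel : Rel x (fun i => decide (P i x = 1))) :
    certP K hK P x ≠ ((hol x : ℕ) : ZMod 3) := by
  rw [traceForm hN x hx] at hrel
  have hodd : cntA K (fun j => argP K hK P j x) ((hol x : ℕ) : ZMod 3) % 2 = 1 := by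
    rw [cntA_argP K hK P x hpre]
    have e : (univ.filter fun k : Fin N => xor (decide (P k x = 1)) (tGuess x k) = true ∧
        ((hol x : ℕ) : ZMod 3) + ((k.val + Wk x k.val : ℕ) : ZMod 3) ≠ 2) =
        (univ.filter fun k : Fin N => xor (decide (P k x = 1)) (tGuess x k) = true ∧
          (k.val + N + Wk x k.val + Wk x (N - 1)) % 3 ≠ 2) := by
      ext k
      simp only [mem_filter, mem_univ, true_and, gcond_iff_Z]
    rw [e]
    exact hrel
  show certA K (fun j => argP K hK P j x) ≠ ((hol x : ℕ) : ZMod 3)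
  unfold certA
  exact certB3_ne _ _ _ _ (xor_parities_false (cntA_sum K _))
    (sel_parity (c := cntA K (fun j => argP K hK P j x)) hodd)
end Prefix

end HolonomyDial

end Summit.QuantumAdvantage.QuantumAdvantage.Theorems
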